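import Literature.Probability.RandomPlanarGeometry.HexSAWSurfaceWallRenewalExcessLimit
import Literature.Probability.RandomPlanarGeometry.HexSAWSurfaceThirdOrderLower
import HarnessLib

/-!
# The flat excursion is an irreducible renewal block: `N₄₁ ≥ 1`, `f₄(y) ≥ y/β(y)⁸`, and the THIRD-order term of the renewal mean
# from below — `m(y) − 1 ≥ 2y/β⁶ + 3y/β⁸`, hence `liminf_{y→∞} y³ (m(y) − 1 − 2y/β(y)⁶) ≥ 3`

Topic `Literature/Probability/RandomPlanarGeometry` (lane «pcv-sawmu», a-idea-1 g30, car «THIRD-LOWER-MEAN»; parents: the pool car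
«EXCESS-LIMIT» `HexSAWSurfaceWallRenewalExcessLimit.lean` (the analytic census of the short irreducible positive wall bridges of the
adsorbed honeycomb wall in the brick-wall frame: `Λ₈(y) = #(ipwb 8)·y` (`IPWB_eight`), `f₄ = #(ipwb 8)·y/β⁸` (`pwbLaw_four`), the head
bound `2f₃ + 3f₄ + 4f₅ ≤ m − 1` (`two_three_four_le_pwbMean_sub_one`), `f₃ = y/β⁶` (`pwbLaw_three`), and the second-order limit
`y²(m − 1) → 2` (`tendsto_sq_mul_pwbMean_sub_one`)) and the TREE module `HexSAWSurfaceThirdOrderLower.lean` (a-p6: the explicit flat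
excursion of length eight `Eight.fw = (0,0)(1,0)(1,−1)(2,−1)(3,−1)(4,−1)(5,−1)(5,0)(6,0)` with `Eight.fw_components`, `Eight.visits_fw = 1`)).

Sources (primary; identifiers verbatim, no quotation marks).  N. Madras, G. Slade, *The Self-Avoiding Walk*, Birkhäuser 1993: Section 1.2,
Definition 1.2.4 (bridges: `x₁(0) < x₁(i) ≤ x₁(n)`) and Section 4.2, Definition 4.2.1 (irreducible bridges), (4.2.2)–(4.2.5) (p. 91: the
renewal law `f_s = Λ_{2s} β^{−2s}` and its mean).  H. Kesten, J. Math. Phys. 4 (1963) 960, Section 4 (irreducible bridges).  I. G. Enting,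
I. Jensen, LNP 775 (2009), Section 7.4.2, Fig. 7.10 (brickwork form of the honeycomb lattice).  N. R. Beaton, M. Bousquet-Mélou, J. de Gier,
H. Duminil-Copin, A. J. Guttmann, CMP 326 (2014) 727 = arXiv:1109.0358v5, Section 3.1, Proposition 5 (p. 9: `μ(y) ≥ max(μ, √y)`).
E. J. Janse van Rensburg, *The Statistical Mechanics of Interacting Walks, Polygons, Animals and Vesicles*, OUP 2000, Section 3.3.2,
Lemma 3.20 (excursions).  H. Duminil-Copin, S. Smirnov, Ann. Math. 175 (2012) 1653, Theorem 1 (`μ = √(2+√2)`).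

## What is proved (namespace `…SAW.HexBW.Wall`; lengths kept symbolic, `{m} (hm : m = 8)`)

* §1 ★ `fw_mem_pwb : Eight.fw ∈ pwb 8` (the flat excursion is a POSITIVE wall bridge: `X = 0,1,1,2,3,4,5,5,6`), ★ `fw_mem_ipwb :
  Eight.fw ∈ ipwb 8` (IRREDUCIBLE: its even-time heights in `[2, 6]` are `−1`, so it has no wall-renewal time), `one_le_card_ipwb_eight :
  1 ≤ #(ipwb 8)` — the census count `N₄₁` of one-visit irreducible blocks of half-length four is POSITIVE, `card_ipwb_eight_le_wbrN :
  #(ipwb 8) ≤ wbrN 8 1` (every such block is a one-visit wall bridge, by «EXCESS-LIMIT»'s `visits_eq_one_of_mem_ipwb_eight`).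
* §2 ★ `le_IPWB_eight_of_nonneg (0 ≤ y) : y ≤ Λ₈(y)`, ★ `div_le_pwbLaw_four (0 ≤ y) : y/β⁸ ≤ f₄(y)`.
* §3 ★★ `two_mul_add_three_mul_le_pwbMean_sub_one (μ⁴ < y) : 2·y/β⁶ + 3·y/β⁸ ≤ m(y) − 1` — the renewal mean to THIRD order from
  below; `three_mul_le_cube_mul (μ⁴ < y) : 3·(y⁴/β⁸) ≤ y³ (m − 1 − 2y/β⁶)`; `tendsto_pow_four_div_wallRate_pow_eight : y⁴/β⁸ → 1`;
  ★★ `eventually_le_cube_mul_pwbMean (0 < ε) : ∀ᶠ y, 3 − ε ≤ y³ (m(y) − 1 − 2y/β(y)⁶)` and ★ `three_le_of_tendsto_cube_mul : (y³ (m − 1 −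
  2y/β⁶) → L) → 3 ≤ L` — i.e. `liminf ≥ 3`: after the second-order term `2/y²` (whose carrier is the dip, `f₃ = y/β⁶ = 1/y² − 3/y⁴ + …`)
  the renewal mean has a third-order term `≥ 3/y³`, carried by the flat excursion.

Mechanism.  Membership is the `decide`d coordinate table of the tree (`Eight.f_facts`) read through `mem_pwb` / `mem_ipwb` exactly as
«EXCESS-LIMIT» did for the dip; then `Λ₈ = N₄₁·y ≥ y`, `f₄ ≥ y/β⁸`, and the head bound `2f₃ + 3f₄ ≤ m − 1` of «EXCESS-LIMIT»; the limit
`y⁴/β⁸ → 1` is the tree's `β/√y → 1` (`tendsto_wallRate_div_sqrt`) to the eighth power.  No enumeration beyond the tree's table: the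
matching UPPER bound at third order needs the counts `N₄₁ ≤ 1`, `N₅₂`, `N₆₃` (NOT proved here).

NOT claimed: `N₄₁ = 1`; the third-order coefficient of `m − 1` (which is `3N₄₁ + 4N₅₂ + 5N₆₃`); anything at `y ≤ μ⁴`; numerics.
-/

namespace Literature.Probability.RandomPlanarGeometry.SAW.HexBW.Wall

open Finset Filter Function
open Literature.Probability.LatticeModels
open _root_.Topology

variable {y : ℝ} {n : ℕ} {ω : ℕ → Site 2}

/-! ### §0  Private numerics -/

/-- `μ² = 2 + √2`. [cite: DuminilCopinSmirnov2012, Theorem 1] -/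
private theorem mu_sq_tl : hexConnectiveConstant ^ 2 = 2 + Real.sqrt 2 := by
  rw [hexConnectiveConstant_eq_inv, inv_pow]; exact inv_eq_of_mul_eq_one_right hexCriticalFugacity_sq

/-- `4 ≤ μ⁴`. [cite: DuminilCopinSmirnov2012, Theorem 1] -/
private theorem four_le_mu_four_tl : 4 ≤ hexConnectiveConstant ^ 4 := by
  have h2 : 0 ≤ Real.sqrt 2 := Real.sqrt_nonneg 2
  calc (4 : ℝ) ≤ (2 + Real.sqrt 2) ^ 2 := by nlinarith
    _ = hexConnectiveConstant ^ 4 := by rw [← mu_sq_tl]; ring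

/-- `μ⁴ < y ⇒ 0 < y`. [cite: DuminilCopinSmirnov2012, Theorem 1] -/
private theorem pos_of_mu_four_lt_tl (hy : hexConnectiveConstant ^ 4 < y) : 0 < y := by
  have := four_le_mu_four_tl; linarith

/-! ### §1  The flat excursion is an irreducible positive wall bridge: `N₄₁ ≥ 1` -/

/-- ★ **The flat excursion is a positive wall bridge** (`X`-coordinates `0,1,1,2,3,4,5,5,6`: strictly positive after time `0`, maximal
at the end); the length is kept symbolic (`m = 8`). [cite: MadrasSlade1993, Section 1.2, Definition 1.2.4] [cite: EntingJensen2009, Section 7.4.2, Fig. 7.10] -/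
theorem fw_mem_pwb {m : ℕ} (hm : m = 8) : Eight.fw ∈ pwb m := by
  rw [mem_pwb, mem_wbr, mem_archs, mem_hpw, mem_saws_iff]
  obtain ⟨h0, hfr, hbw, hinj, hH, harch, hwb⟩ := Eight.fw_components
  subst hm
  refine ⟨⟨⟨⟨⟨h0, hfr, hbw, hinj⟩, hH⟩, harch⟩, hwb⟩, fun i h1 h2 => ?_⟩
  simp only [Eight.fw, Arm.pt_apply_zero, min_eq_left h2, Nat.zero_min, min_self]
  interval_cases i <;> decide

/-- ★ **The flat excursion is irreducible**: its heights at the even times `2, 4, 6` are `−1`, so it has no wall-renewal time in `[1, 8)`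
(symbolic length). [cite: MadrasSlade1993, Section 4.2, Definition 4.2.1] [cite: Kesten1963SAW, Section 4] [cite: EntingJensen2009, Section 7.4.2, Fig. 7.10] -/
theorem fw_mem_ipwb {m : ℕ} (hm : m = 8) : Eight.fw ∈ ipwb m := by
  rw [mem_ipwb]
  refine ⟨fw_mem_pwb hm, by omega, fun k hk1 hk2 h => ?_⟩
  have hk : k % 2 = 0 := h.2.1
  have hY : Eight.fw k 1 = 0 := h.2.2
  subst hm
  simp only [Eight.fw, Arm.pt_apply_one, min_eq_left hk2.le] at hY
  interval_cases k
  all_goals first | omega | (revert hY; decide)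

/-- `N₄₁ ≥ 1`: there is at least one irreducible positive wall bridge of length eight (symbolic length).
[cite: MadrasSlade1993, Section 4.2, Definition 4.2.1, (4.2.2)] [cite: JansevanRensburg2000, Section 3.3.2, Lemma 3.20] -/
theorem one_le_card_ipwb_eight {m : ℕ} (hm : m = 8) : 1 ≤ #(ipwb m) :=
  Finset.card_pos.2 ⟨_, fw_mem_ipwb hm⟩

open Classical in
/-- `N₄₁ ≤ h₈`: every irreducible positive wall bridge of length eight is a ONE-visit wall bridge («EXCESS-LIMIT»'s census), so
`#(ipwb 8) ≤ wbrN 8 1` (symbolic length). [cite: MadrasSlade1993, Section 4.2, (4.2.2)] [cite: JansevanRensburg2000, Section 3.3.2, Lemma 3.20] -/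
theorem card_ipwb_eight_le_wbrN {m : ℕ} (hm : m = 8) : #(ipwb m) ≤ wbrN m 1 := by
  rw [wbrN]
  exact Finset.card_le_card fun ω hω =>
    Finset.mem_filter.2 ⟨pwb_subset (ipwb_subset hω), visits_eq_one_of_mem_ipwb_eight hm hω⟩

/-! ### §2  `Λ₈(y) ≥ y` and `f₄(y) ≥ y/β(y)⁸` -/

/-- ★ `y ≤ Λ₈(y)` for `y ≥ 0` (symbolic length): `Λ₈ = N₄₁·y` with `N₄₁ ≥ 1`. [cite: MadrasSlade1993, Section 4.2, (4.2.2)] -/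
theorem le_IPWB_eight_of_nonneg {m : ℕ} (hm : m = 8) (hy : 0 ≤ y) : y ≤ IPWB m y := by
  rw [IPWB_eight hm]
  have h1 : (1 : ℝ) ≤ #(ipwb m) := by exact_mod_cast one_le_card_ipwb_eight hm
  nlinarith

/-- ★ `y/β(y)⁸ ≤ f₄(y)` for `y ≥ 0`. [cite: MadrasSlade1993, Section 4.2, (4.2.2), (4.2.4)] -/
theorem div_le_pwbLaw_four (hy : 0 ≤ y) : y / wallRate y ^ 8 ≤ pwbLaw y 4 := by
  have key : ∀ m, m = 8 → y / wallRate y ^ 8 ≤ pwbLaw y 4 := by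
    intro m hm
    rw [pwbLaw_four hm]
    exact div_le_div_of_nonneg_right ((le_IPWB_eight_of_nonneg hm hy).trans_eq (IPWB_eight hm y)) (pow_pos (wallRate_pos y) 8).le
  exact key 8 rfl

/-! ### §3  The renewal mean to third order from below -/

/-- ★★ **`2y/β(y)⁶ + 3y/β(y)⁸ ≤ m(y) − 1`** (`y > μ⁴`): the head bound `2f₃ + 3f₄ + 4f₅ ≤ m − 1` with `f₃ = y/β⁶`, `f₄ ≥ y/β⁸`,
`f₅ ≥ 0`. [cite: MadrasSlade1993, Section 4.2, (4.2.2)-(4.2.5) (p. 91)] [cite: Kesten1963SAW, Section 4] -/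
theorem two_mul_add_three_mul_le_pwbMean_sub_one (hy : hexConnectiveConstant ^ 4 < y) :
    2 * (y / wallRate y ^ 6) + 3 * (y / wallRate y ^ 8) ≤ pwbMean y - 1 := by
  have hy0 : 0 ≤ y := (pos_of_mu_four_lt_tl hy).le
  have h := two_three_four_le_pwbMean_sub_one hy
  have h3 : pwbLaw y 3 = y / wallRate y ^ 6 := pwbLaw_three y
  have h4 := div_le_pwbLaw_four hy0
  have h5 := pwbLaw_nonneg hy0 5
  linarith

/-- `3·(y⁴/β⁸) ≤ y³ (m(y) − 1 − 2y/β(y)⁶)` (`y > μ⁴`). [cite: MadrasSlade1993, Section 4.2, (4.2.5) (p. 91)] -/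
theorem three_mul_le_cube_mul (hy : hexConnectiveConstant ^ 4 < y) :
    3 * (y ^ 4 / wallRate y ^ 8) ≤ y ^ 3 * (pwbMean y - 1 - 2 * y / wallRate y ^ 6) := by
  have hy0 : 0 < y := pos_of_mu_four_lt_tl hy
  have h := two_mul_add_three_mul_le_pwbMean_sub_one hy
  have e1 : 3 * (y ^ 4 / wallRate y ^ 8) = y ^ 3 * (3 * (y / wallRate y ^ 8)) := by ring
  have e2 : y ^ 3 * (pwbMean y - 1 - 2 * y / wallRate y ^ 6) = y ^ 3 * (pwbMean y - 1 - 2 * (y / wallRate y ^ 6)) := by ring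
  rw [e1, e2]
  exact mul_le_mul_of_nonneg_left (by linarith) (pow_pos hy0 3).le

/-- `y⁴/β(y)⁸ → 1` (`β ∼ √y`). [cite: BeatonBousquetMelouDeGierDuminilCopinGuttmann2014, Section 3.1, Proposition 5 (arXiv v5 p. 9)] -/
theorem tendsto_pow_four_div_wallRate_pow_eight : Tendsto (fun y : ℝ => y ^ 4 / wallRate y ^ 8) atTop (𝓝 1) := by
  have h1 : Tendsto (fun y : ℝ => ((wallRate y / Real.sqrt y) ^ 8)⁻¹) atTop (𝓝 ((1 : ℝ) ^ 8)⁻¹) :=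
    (tendsto_wallRate_div_sqrt.pow 8).inv₀ (by norm_num)
  rw [one_pow, inv_one] at h1
  refine h1.congr' ?_
  filter_upwards [eventually_gt_atTop (0 : ℝ)] with y hy
  have hs : Real.sqrt y ^ 8 = y ^ 4 := by
    rw [show (8 : ℕ) = 2 * 4 by norm_num, pow_mul, Real.sq_sqrt hy.le]
  rw [div_pow, hs, inv_div]

/-- ★★ **`liminf_{y→∞} y³ (m(y) − 1 − 2y/β(y)⁶) ≥ 3`**, as an eventual inequality: for every `ε > 0`, eventually
`3 − ε ≤ y³ (m(y) − 1 − 2y/β(y)⁶)`. [cite: MadrasSlade1993, Section 4.2, (4.2.5) (p. 91)] [cite: JansevanRensburg2000, Section 3.3.2, Lemma 3.20] -/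
theorem eventually_le_cube_mul_pwbMean {ε : ℝ} (hε : 0 < ε) :
    ∀ᶠ y : ℝ in atTop, 3 - ε ≤ y ^ 3 * (pwbMean y - 1 - 2 * y / wallRate y ^ 6) := by
  have h1 : ∀ᶠ y : ℝ in atTop, 1 - ε / 3 < y ^ 4 / wallRate y ^ 8 :=
    tendsto_pow_four_div_wallRate_pow_eight.eventually (eventually_gt_nhds (by linarith))
  filter_upwards [h1, eventually_gt_atTop (hexConnectiveConstant ^ 4)] with y hy1 hy2
  have h3 := three_mul_le_cube_mul hy2
  linarith

/-- ★ If the third-order limit `L = lim y³ (m(y) − 1 − 2y/β(y)⁶)` exists, then `3 ≤ L`. [cite: MadrasSlade1993, Section 4.2, (4.2.5) (p. 91)] -/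
theorem three_le_of_tendsto_cube_mul {L : ℝ}
    (hL : Tendsto (fun y : ℝ => y ^ 3 * (pwbMean y - 1 - 2 * y / wallRate y ^ 6)) atTop (𝓝 L)) : 3 ≤ L := by
  have h3 : Tendsto (fun y : ℝ => 3 * (y ^ 4 / wallRate y ^ 8)) atTop (𝓝 3) := by
    simpa using tendsto_pow_four_div_wallRate_pow_eight.const_mul 3
  refine le_of_tendsto_of_tendsto h3 hL ?_
  filter_upwards [eventually_gt_atTop (hexConnectiveConstant ^ 4)] with y hy
  exact three_mul_le_cube_mul hy

/-- ★ **The second-order term identified with its carrier**: `y²·(2y/β⁶) → 2` (the dip) — so «EXCESS-LIMIT»'s `y²(m − 1) → 2` is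
EXACTLY the dip's contribution, and what is left, `m − 1 − 2y/β⁶`, is `O⁺(y⁻³)` from below with constant `≥ 3` (the flat excursion).
[cite: MadrasSlade1993, Section 4.2, (4.2.5) (p. 91)] [cite: EntingJensen2009, Section 7.4.2, Fig. 7.10] -/
theorem tendsto_sq_mul_two_mul_div_wallRate_pow_six : Tendsto (fun y : ℝ => y ^ 2 * (2 * y / wallRate y ^ 6)) atTop (𝓝 2) := by
  have h1 : Tendsto (fun y : ℝ => ((wallRate y / Real.sqrt y) ^ 6)⁻¹) atTop (𝓝 ((1 : ℝ) ^ 6)⁻¹) :=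
    (tendsto_wallRate_div_sqrt.pow 6).inv₀ (by norm_num)
  rw [one_pow, inv_one] at h1
  have h2 : Tendsto (fun y : ℝ => 2 * ((wallRate y / Real.sqrt y) ^ 6)⁻¹) atTop (𝓝 2) := by
    simpa using h1.const_mul 2
  refine h2.congr' ?_
  filter_upwards [eventually_gt_atTop (0 : ℝ)] with y hy
  have hs : Real.sqrt y ^ 6 = y ^ 3 := by
    rw [show (6 : ℕ) = 2 * 3 by norm_num, pow_mul, Real.sq_sqrt hy.le]
  rw [div_pow, hs, inv_div]
  ring

/-- `y²(m(y) − 1 − 2y/β(y)⁶) → 0`: to second order the dip accounts for the whole renewal excess. [cite: MadrasSlade1993, Section 4.2, (4.2.5) (p. 91)] -/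
theorem tendsto_sq_mul_pwbMean_sub_one_sub : Tendsto (fun y : ℝ => y ^ 2 * (pwbMean y - 1 - 2 * y / wallRate y ^ 6)) atTop (𝓝 0) := by
  have h := tendsto_sq_mul_pwbMean_sub_one.sub tendsto_sq_mul_two_mul_div_wallRate_pow_six
  rw [sub_self] at h
  exact h.congr fun y => by ring

end Literature.Probability.RandomPlanarGeometry.SAW.HexBW.Wall
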